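import Literature.MathematicalPhysics.KineticTheory.TaggedSphereWindowCount
import Literature.MathematicalPhysics.KineticTheory.CollisionFluxUpperBound
import Literature.MathematicalPhysics.KineticTheory.HardSphereCanonicalPairBound
import Literature.MathematicalPhysics.KineticTheory.EvenStatTruncationBound
import Literature.MathematicalPhysics.KineticTheory.CollisionTubeWeightOscillation
import Summits.AtomisticToContinuum.HydrodynamicLimit.Theorems.LambertianContactSwapCollisionMomentBoundFlux
import Summits.AtomisticToContinuum.HydrodynamicLimit.Theorems.InformationPercolationEngineCollisionRateWindowCountMeasurable
import Summits.AtomisticToContinuum.HydrodynamicLimit.Theorems.JParityClosureCollisionTightnessSweptTube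
import Summits.AtomisticToContinuum.HydrodynamicLimit.Theorems.JParityClosureCollisionTightnessTorusGibbs
import Summits.AtomisticToContinuum.HydrodynamicLimit.Theorems.JParityClosureOddContactSymmetryGibbsInvariance
import HarnessLib

/-!
# `InformationPercolationEngine.CollisionRate` (crux stmt-AtomisticToContinuum-13481), line `Sketch`, card
# `hazard-fairness-compensator`: S5|const (`stub_windowCountSquareTightConst`) — the one-window first moment, and the
# reduction of the stub to the `N`-uniform one-window SECOND moment

Helper file (`--supports stmt-AtomisticToContinuum-13481`) written by the line lead's stub worker for S5|const.  At RUNG 0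
(constant profiles `ab, θb > 0`, `ub`) the local Gibbs law is the homogeneous canonical Gibbs law `G_N`, invariant under
every hard-sphere flow (`measurePreserving_flow_localGibbsLaw_const`); `D_{i,k} = windowCollisions σ N Φ τ a i k` is the
number of collision times of sphere `i` in window `k` (`Literature/…/CollisionWindowCompensator`: `Kw` windows of length
`w ≤ a (N+1)^{-1/3}` tiling `[0, τ)`), and the registered stub asks for the tightness, uniformly in `N`, of the squared
window sum `F = ε/(N+1) · Σ_i Σ_{k<Kw} D_{i,k}²` under `G_N`.

§1 (first moment, PROVED).  `lintegral_ncard_collisionTimesOf_le`: for `σ ≤ 1/2` and the abstract static inputs of the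
collision-flux bound (invariance, Ruelle pair bound `≤ 4 ×` Haar, swept tubes, minimal-image lifts) the mean number of
collision times of ONE sphere in `[0, T]` is `≤ 32 T (N+1) ε² ∫ ‖w − v‖ dN(u,θ)^{⊗2}` — the window bound in
lower-integral form (`LambertianContactSwapCollisionMomentBound.lintegral_indicator_collisionSum_le_liminf`) for the mark
`𝟙[p = i ∨ q = i]` (pathwise domination `ncard_collisionTimesOf_inter_Icc_le_finsum`), whose one-window means are the
two-label static bounds of `exists_windowEvent` over the `2(N+1)` ordered pairs through `i`; the mesh cancels exactly.
Hence `lintegral_windowCollisions_zero_le` (`∫ D_{i,0} dG_N ≤ 32 σ² a ∫‖w − v‖`, `(N+1) ε² w ≤ σ² a`) and, with the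
inputs DISCHARGED at small reduced density (`posGibbs_pairEvent_le`, `exists_sweptTube`,
`volume_setOf_exists_reprSym_add_latticeVec_mem_le`) and every window `k` (shift identity + invariance),
`lintegral_windowCollisions_const_le` / `sum_lintegral_windowCollisions_const_le`:
`Σ_i ∫ D_{i,k} dG_N ≤ (N+1) · 32 σ² a ∫‖w − v‖ < ∞`, uniformly in `N ≥ 1` and `k` (Boltzmann's collision frequency of a
tagged sphere as an upper bound; Cercignani–Illner–Pulvirenti 1994, App. 4.A).  `measurable_windowCollisions`: H1.

§2 (reduction, PROVED).  `stub_windowCountSquareTightConst_of_sqMoment`: the stub's conclusion VERBATIM from ONE hypothesis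

  (PM|const)  `∀` constant profiles, small `σ`, every flow, `τ, a > 0`: `∃ C ∃ N₀ ∀ N ≥ N₀, Σ_i ∫ D_{i,0}² dG_N ≤ C (N+1)`,

by Markov and stationarity (`measure_lt_windowSqSum_le` of `Literature/…/TaggedSphereWindowCount`; the bad set is
`G_N`-null; the counts are measurable; every window has the law of window `0`) and `ε Kw ≤ σ (τ/a + 1)`
(`hsDiameter_mul_windowNum_le`), with `Kb = (σ (τ/a + 1) max(C, 0) + 1)/δ`.

Status of (PM|const) — NOT proved, and why.  `E[D²] = E[D] + E[D(D − 1)]`; §1 is the first term.  The second factorial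
moment counts ordered pairs of DISTINCT collisions of one sphere inside one window: the later collision happens an order-`w`
time after the earlier one, after the velocity of `i` has been changed by the earlier collision and while its new partner
may have been deflected towards it by further bodies; read at any single time it is a TWO-TIME correlation
`G_N(S ∩ Φ_t⁻¹ S')` of two rare static events under the flow, which the one-window machinery of `CollisionFluxUpperBound`
does not control (its exactness along backward free flights holds for ONE collision, not for two collisions a time `w`
apart; Hölder in between loses the factor `N` that the tube volume `ε² w` must absorb).  Bounding it uniformly in `N` is a
collision-history (pseudo-trajectory / tree) estimate of Lanford type at fixed reduced density together with a control of
chattering recollisions — the class of the line's general stub S5, not a static window event.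

References: C. Cercignani, R. Illner, M. Pulvirenti, *The Mathematical Theory of Dilute Gases* (1994), App. 4.A;
I. Gallagher, L. Saint-Raymond, B. Texier, *From Newton to Boltzmann* (2013), Prop. 4.1.1 and Part III; H. Spohn,
*Large Scale Dynamics of Interacting Particles* (1991), Part I §2.3.
-/

noncomputable section

open MeasureTheory Set Filter Topology
open scoped ENNReal InnerProductSpace BigOperators Classical

namespace Summit.AtomisticToContinuum.HydrodynamicLimit.Theorems.CollisionRate

open Literature.Analysis.FluidPDE Literature.Analysis.FunctionSpaces Literature.MathematicalPhysics.KineticTheory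
open Summit.AtomisticToContinuum.HydrodynamicLimit.Theorems.LambertianContactSwapCollisionMomentBound
  (lintegral_indicator_collisionSum_le_liminf)

/-! ## §1 The first moment of the tagged-sphere collision count at rung 0 -/

/-- **First moment of the collision count of ONE sphere under the homogeneous Gibbs law.**  For `σ ≤ 1/2`,
constant profiles `a, θ > 0`, `u`, a hard-sphere flow `Φ` of `N + 1` spheres of diameter `ε = hsDiameter σ N` on
`𝕋³` preserving the homogeneous Gibbs law `G_N` (`hstat`), a canonical pair law at most `4 ×` Haar measure
(`hpair`), swept-tube families (`htube`) and the minimal-image lift inequality (`hlift`) — the hypotheses of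
`localGibbsLaw_collisionMarkSum_ge_le` —, for every `T > 0` and every sphere `i` the mean number of collision
times of `i` in `[0, T]` (count extended by `0` off the good set) is at most
`32 T (N+1) ε² · ∫ ‖w − v‖ dN(u,θ)(v) dN(u,θ)(w)`: the window bound in lower-integral form
(`lintegral_indicator_collisionSum_le_liminf`) for the mark `𝟙[p = i ∨ q = i]`, whose one-window means are the
static two-label bounds of `exists_windowEvent`, summed over the `2(N+1)` ordered pairs through `i`; the mesh
cancels exactly.  (Boltzmann's collision frequency of a tagged sphere, `n ε² ⟨‖v − w‖⟩`, as an upper bound;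
Cercignani–Illner–Pulvirenti 1994 App. 4.A.) [folklore] -/
theorem lintegral_ncard_collisionTimesOf_le {σ : ℝ} (hσ2 : σ ≤ 1 / 2) {a θ : ℝ} (ha : 0 < a)
    (hθ : 0 < θ) (u : V3) {N : ℕ} (Φ : HardSphereFlow (Torus.geometry (Fin 3)) (hsDiameter σ N) (N + 1))
    (hstat : ∀ t : ℝ, MeasurePreserving (Φ.flow t) (localGibbsLaw σ (fun _ => a) (fun _ => u) (fun _ => θ) N Φ)
      (localGibbsLaw σ (fun _ => a) (fun _ => u) (fun _ => θ) N Φ))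
    (hpair : ∀ i j : Fin (N + 1), i ≠ j → ∀ T : Set T3, MeasurableSet T →
      posGibbsMeasure (fun _ : T3 => (1 : ℝ)) (hsDiameter σ N) (N + 1) {x | x i - x j ∈ T} ≤ 4 * volume T)
    (htube : ∀ h : ℝ, 0 ≤ h → ∃ S : V3 → Set V3, MeasurableSet {q : V3 × V3 | q.1 ∈ S q.2} ∧
      (∀ u, volume (S u) ≤ ENNReal.ofReal (4 * hsDiameter σ N ^ 2 * h * ‖u‖)) ∧
      ∀ (u r : V3) (s : ℝ), hsDiameter σ N ≤ ‖r‖ → s ∈ Icc 0 h → ‖r + s • u‖ = hsDiameter σ N → r ∈ S u)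
    (hlift : ∀ B : Set V3, MeasurableSet B →
      volume {x : T3 | ∃ k : Fin 3 → ℤ, Torus.reprSym x + Torus.latticeVec k ∈ B} ≤ volume B)
    {T : ℝ} (hT : 0 < T) (i : Fin (N + 1)) :
    ∫⁻ z, Φ.good.indicator (fun z => ((collisionTimesOf (Torus.geometry (Fin 3)) (hsDiameter σ N)
        (fun t => Φ.flow t z) i ∩ Icc 0 T).ncard : ℝ≥0∞)) z
        ∂(localGibbsLaw σ (fun _ => a) (fun _ => u) (fun _ => θ) N Φ) ≤
      ENNReal.ofReal (32 * T * ((N + 1 : ℕ) : ℝ) * hsDiameter σ N ^ 2) *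
        ∫⁻ p, ENNReal.ofReal ‖p.2 - p.1‖ ∂((gaussMeasure u θ).prod (gaussMeasure u θ)) := by
  set P := localGibbsLaw σ (fun _ => a) (fun _ => u) (fun _ => θ) N Φ with hPdef
  set I : ℝ≥0∞ := ∫⁻ p, ENNReal.ofReal ‖p.2 - p.1‖ ∂((gaussMeasure u θ).prod (gaussMeasure u θ)) with hIdef
  -- the mark `𝟙[p = i ∨ q = i]`, a constant function of the configuration
  set F : Config (N + 1) (Fin 3) T3 → Fin (N + 1) → Fin (N + 1) → ℝ≥0∞ :=
    fun _ p q => if p = i ∨ q = i then 1 else 0 with hFdef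
  have hFm : ∀ p q, Measurable fun w => F w p q := fun p q => measurable_const
  -- the window events, for every mesh `T / M` and every ordered pair
  have hev : ∀ (M : ℕ) (p q : Fin (N + 1)), ∃ E : Set (Config (N + 1) (Fin 3) T3), MeasurableSet E ∧
      (p ≠ q → ∀ w ∈ hardSphereDomain (Torus.geometry (Fin 3)) (N + 1) (hsDiameter σ N),
        ∀ t ∈ Icc 0 (T / M),
        ‖(Torus.geometry (Fin 3)).sepVec ((freeFlight (Torus.geometry (Fin 3)) (-t) w p).1)
          ((freeFlight (Torus.geometry (Fin 3)) (-t) w q).1)‖ = hsDiameter σ N → w ∈ E) ∧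
      (p ≠ q → ∫⁻ w, E.indicator (fun w => F w p q) w ∂P ≤
        ENNReal.ofReal (16 * hsDiameter σ N ^ 2 * (T / M)) * ((if p = i ∨ q = i then 1 else 0) * I)) := by
    intro M p q
    by_cases hpq : p ≠ q
    · have hh : 0 ≤ T / M := div_nonneg hT.le (Nat.cast_nonneg M)
      obtain ⟨S, hSm, hSvol, hS⟩ := htube (T / M) hh
      obtain ⟨E, hEm, hEc, hEb⟩ := exists_windowEvent hσ2 ha hθ u hh hpq (hpair p q hpq) hSm hSvol hS hlift
      refine ⟨E, hEm, fun _ => hEc, fun _ => (hEb Φ (fun _ => if p = i ∨ q = i then 1 else 0)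
        measurable_const).trans (le_of_eq ?_)⟩
      rw [lintegral_mul_const _ (by fun_prop), hIdef, mul_comm I]
    · exact ⟨∅, MeasurableSet.empty, fun h => absurd h hpq, fun h => absurd h hpq⟩
  choose E hEm hEc hEb using hev
  -- the window bound in lower-integral form
  have hgen := lintegral_indicator_collisionSum_le_liminf Φ P hstat hT F (fun M p q => E M p q) hEm
    (fun M p q hpq => hEc M p q hpq) (fun _ => F) (fun _ p q => hFm p q) (fun M p q _ w _ t _ _ => le_rfl)
  -- the mean of one window: `2(N+1)` ordered pairs through `i`, and `M · (T/M) = T`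
  have hB : ∀ M : ℕ, (M : ℝ≥0∞) * ∫⁻ w, ∑ p, ∑ q,
      (if p ≠ q then (E M p q).indicator (fun w => F w p q) w else 0) ∂P ≤
        ENNReal.ofReal (32 * T * ((N + 1 : ℕ) : ℝ) * hsDiameter σ N ^ 2) * I := by
    intro M
    rcases Nat.eq_zero_or_pos M with hM0 | hM0
    · subst hM0
      simp only [Nat.cast_zero, zero_mul, zero_le]
    set B : ℝ≥0∞ := ENNReal.ofReal (16 * hsDiameter σ N ^ 2 * (T / M)) * I with hBdef
    have hterm : ∀ p q : Fin (N + 1), ∫⁻ w, (if p ≠ q then (E M p q).indicator (fun w => F w p q) w else 0) ∂P ≤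
        (if p = i then B else 0) + (if q = i then B else 0) := by
      intro p q
      by_cases hpq : p ≠ q
      · simp only [if_pos hpq]
        by_cases hi : p = i ∨ q = i
        · have h1 := hEb M p q hpq
          rw [if_pos hi, one_mul] at h1
          refine h1.trans ?_
          rcases hi with hp | hq
          · rw [if_pos hp]; exact le_self_add
          · rw [if_pos hq]; exact le_add_self
        · have h0 : ∀ w, (E M p q).indicator (fun w => F w p q) w = 0 := by
            intro w; simp only [hFdef, if_neg hi, Set.indicator_apply, ite_self]
          simp only [h0, lintegral_const, zero_mul, zero_le]
      · simp only [if_neg hpq, lintegral_zero, zero_le]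
    have hmeas : ∀ p q : Fin (N + 1), Measurable fun w : Config (N + 1) (Fin 3) T3 =>
        (if p ≠ q then (E M p q).indicator (fun w => F w p q) w else 0) := by
      intro p q
      by_cases hpq : p ≠ q
      · simp only [if_pos hpq]; exact (hFm p q).indicator (hEm M p q)
      · simp only [if_neg hpq]; exact measurable_const
    have hδ : ∑ p : Fin (N + 1), (if p = i then B else 0) = B := by
      rw [Finset.sum_ite_eq']; simp
    have hsum : ∑ p : Fin (N + 1), ∑ q : Fin (N + 1), ((if p = i then B else 0) + (if q = i then B else 0)) =
        ((N + 1 : ℕ) : ℝ≥0∞) * B + ((N + 1 : ℕ) : ℝ≥0∞) * B := by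
      simp only [Finset.sum_add_distrib, Finset.sum_const, Finset.card_univ, Fintype.card_fin, hδ,
        nsmul_eq_mul]
      rw [← Finset.mul_sum, hδ]
    calc (M : ℝ≥0∞) * ∫⁻ w, ∑ p, ∑ q, (if p ≠ q then (E M p q).indicator (fun w => F w p q) w else 0) ∂P
        = (M : ℝ≥0∞) * ∑ p, ∑ q, ∫⁻ w, (if p ≠ q then (E M p q).indicator (fun w => F w p q) w else 0) ∂P := by
          congr 1
          rw [lintegral_finsetSum _ fun p _ => Finset.measurable_sum _ fun q _ => hmeas p q]
          exact Finset.sum_congr rfl fun p _ => lintegral_finsetSum _ fun q _ => hmeas p q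
      _ ≤ (M : ℝ≥0∞) * ∑ p : Fin (N + 1), ∑ q : Fin (N + 1), ((if p = i then B else 0) + (if q = i then B else 0)) := by
          gcongr with p _ q _
          exact hterm p q
      _ = (M : ℝ≥0∞) * (((N + 1 : ℕ) : ℝ≥0∞) * B + ((N + 1 : ℕ) : ℝ≥0∞) * B) := by rw [hsum]
      _ = ENNReal.ofReal (32 * T * ((N + 1 : ℕ) : ℝ) * hsDiameter σ N ^ 2) * I := by
          rw [hBdef]
          have h1 : (M : ℝ≥0∞) = ENNReal.ofReal (M : ℝ) := (ENNReal.ofReal_natCast M).symm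
          have h2 : ((N + 1 : ℕ) : ℝ≥0∞) = ENNReal.ofReal ((N + 1 : ℕ) : ℝ) := (ENNReal.ofReal_natCast _).symm
          have hM' : (0 : ℝ) < M := by exact_mod_cast hM0
          rw [← two_mul, h1, h2, ← ENNReal.ofReal_ofNat 2]
          simp only [← mul_assoc]
          rw [← ENNReal.ofReal_mul (Nat.cast_nonneg _), ← ENNReal.ofReal_mul (by positivity),
            ← ENNReal.ofReal_mul (by positivity)]
          congr 1
          congr 1
          field_simp
          ring
  -- the count is dominated pathwise by the collision sum of the mark
  calc ∫⁻ z, Φ.good.indicator (fun z => ((collisionTimesOf (Torus.geometry (Fin 3)) (hsDiameter σ N)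
          (fun t => Φ.flow t z) i ∩ Icc 0 T).ncard : ℝ≥0∞)) z ∂P
      ≤ ∫⁻ z, Φ.good.indicator (fun z => ∑ᶠ s ∈ collisionTimes (Torus.geometry (Fin 3)) (hsDiameter σ N)
          (fun t => Φ.flow t z) ∩ Icc 0 T, ∑ p, ∑ q,
            (if p ≠ q ∧ ‖(Torus.geometry (Fin 3)).sepVec (Φ.flow s z p).1 (Φ.flow s z q).1‖ = hsDiameter σ N
              then F (Φ.flow s z) p q else 0)) z ∂P := by
        refine lintegral_mono fun z => ?_
        by_cases hz : z ∈ Φ.good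
        · rw [indicator_of_mem hz, indicator_of_mem hz]
          exact ncard_collisionTimesOf_inter_Icc_le_finsum Φ hz i T
        · rw [indicator_of_notMem hz, indicator_of_notMem hz]
    _ ≤ _ := hgen
    _ ≤ ENNReal.ofReal (32 * T * ((N + 1 : ℕ) : ℝ) * hsDiameter σ N ^ 2) * I :=
        liminf_le_of_frequently_le' (Frequently.of_forall hB)


/-- **The one-window count of a tagged sphere has mean `O(σ² a)`, uniformly in `N`.**  Under the hypotheses of
`lintegral_ncard_collisionTimesOf_le` (with `0 < σ ≤ 1/2`), for windows of nominal length a fraction `aw > 0` of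
the mean free time (`windowLen N τ aw ≤ aw (N+1)^{-1/3}`, `windowLen_le`) and every sphere `i`,
`∫ D_{i,0} dG_N ≤ 32 σ² aw · ∫ ‖w − v‖ dN(u,θ)^{⊗2}`: the window `[0, w)` lies in `[0, w]`, and
`(N+1) ε² w ≤ σ² aw` (`succ_mul_hsDiameter_sq_mul_nominalWindow`). [folklore] -/
theorem lintegral_windowCollisions_zero_le {σ : ℝ} (hσ : 0 < σ) (hσ2 : σ ≤ 1 / 2) {a θ : ℝ} (ha : 0 < a)
    (hθ : 0 < θ) (u : V3) {N : ℕ} (Φ : HardSphereFlow (Torus.geometry (Fin 3)) (hsDiameter σ N) (N + 1))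
    (hstat : ∀ t : ℝ, MeasurePreserving (Φ.flow t) (localGibbsLaw σ (fun _ => a) (fun _ => u) (fun _ => θ) N Φ)
      (localGibbsLaw σ (fun _ => a) (fun _ => u) (fun _ => θ) N Φ))
    (hpair : ∀ i j : Fin (N + 1), i ≠ j → ∀ T : Set T3, MeasurableSet T →
      posGibbsMeasure (fun _ : T3 => (1 : ℝ)) (hsDiameter σ N) (N + 1) {x | x i - x j ∈ T} ≤ 4 * volume T)
    (htube : ∀ h : ℝ, 0 ≤ h → ∃ S : V3 → Set V3, MeasurableSet {q : V3 × V3 | q.1 ∈ S q.2} ∧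
      (∀ u, volume (S u) ≤ ENNReal.ofReal (4 * hsDiameter σ N ^ 2 * h * ‖u‖)) ∧
      ∀ (u r : V3) (s : ℝ), hsDiameter σ N ≤ ‖r‖ → s ∈ Icc 0 h → ‖r + s • u‖ = hsDiameter σ N → r ∈ S u)
    (hlift : ∀ B : Set V3, MeasurableSet B →
      volume {x : T3 | ∃ k : Fin 3 → ℤ, Torus.reprSym x + Torus.latticeVec k ∈ B} ≤ volume B)
    {τ aw : ℝ} (hτ : 0 < τ) (haw : 0 < aw) (i : Fin (N + 1)) :
    ∫⁻ z, ENNReal.ofReal (windowCollisions σ N Φ τ aw i 0 z)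
        ∂(localGibbsLaw σ (fun _ => a) (fun _ => u) (fun _ => θ) N Φ) ≤
      ENNReal.ofReal (32 * σ ^ 2 * aw) *
        ∫⁻ p, ENNReal.ofReal ‖p.2 - p.1‖ ∂((gaussMeasure u θ).prod (gaussMeasure u θ)) := by
  set w : ℝ := windowLen N τ aw with hwdef
  have hw : 0 < w := windowLen_pos N hτ haw
  -- the window `[0, w)` lies in `[0, w]`
  have hpt : ∀ z, ENNReal.ofReal (windowCollisions σ N Φ τ aw i 0 z) ≤
      Φ.good.indicator (fun z => ((collisionTimesOf (Torus.geometry (Fin 3)) (hsDiameter σ N)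
        (fun t => Φ.flow t z) i ∩ Icc 0 w).ncard : ℝ≥0∞)) z := by
    intro z
    unfold windowCollisions window
    by_cases hz : z ∈ Φ.good
    · rw [if_pos hz, indicator_of_mem hz, ENNReal.ofReal_natCast]
      have hfin : (collisionTimesOf (Torus.geometry (Fin 3)) (hsDiameter σ N) (fun t => Φ.flow t z) i ∩
          Icc 0 w).Finite :=
        ((Φ.isTrajectory z hz).locFinite 0 w).subset (inter_subset_inter_left _ (collisionTimesOf_subset _ i))
      push_cast
      rw [zero_mul, zero_add, one_mul]
      exact_mod_cast Set.ncard_le_ncard (inter_subset_inter_right _ Ico_subset_Icc_self) hfin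
    · rw [if_neg hz, indicator_of_notMem hz, ENNReal.ofReal_zero]
  -- `32 w (N+1) ε² ≤ 32 σ² aw`
  have hconst : 32 * w * ((N + 1 : ℕ) : ℝ) * hsDiameter σ N ^ 2 ≤ 32 * σ ^ 2 * aw := by
    have hwle : w ≤ aw * ((N + 1 : ℕ) : ℝ) ^ (-(1 / 3 : ℝ)) := windowLen_le N hτ haw
    have hkey := succ_mul_hsDiameter_sq_mul_nominalWindow hσ N aw
    have hpos : 0 ≤ 32 * ((N + 1 : ℕ) : ℝ) * hsDiameter σ N ^ 2 := by positivity
    calc 32 * w * ((N + 1 : ℕ) : ℝ) * hsDiameter σ N ^ 2 = 32 * ((N + 1 : ℕ) : ℝ) * hsDiameter σ N ^ 2 * w := by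
          ring
      _ ≤ 32 * ((N + 1 : ℕ) : ℝ) * hsDiameter σ N ^ 2 * (aw * ((N + 1 : ℕ) : ℝ) ^ (-(1 / 3 : ℝ))) :=
          mul_le_mul_of_nonneg_left hwle hpos
      _ = 32 * σ ^ 2 * aw := by rw [mul_assoc 32 (σ ^ 2) aw, ← hkey]; ring
  calc ∫⁻ z, ENNReal.ofReal (windowCollisions σ N Φ τ aw i 0 z)
        ∂(localGibbsLaw σ (fun _ => a) (fun _ => u) (fun _ => θ) N Φ)
      ≤ ∫⁻ z, Φ.good.indicator (fun z => ((collisionTimesOf (Torus.geometry (Fin 3)) (hsDiameter σ N)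
          (fun t => Φ.flow t z) i ∩ Icc 0 w).ncard : ℝ≥0∞)) z
          ∂(localGibbsLaw σ (fun _ => a) (fun _ => u) (fun _ => θ) N Φ) := lintegral_mono hpt
    _ ≤ ENNReal.ofReal (32 * w * ((N + 1 : ℕ) : ℝ) * hsDiameter σ N ^ 2) *
          ∫⁻ p, ENNReal.ofReal ‖p.2 - p.1‖ ∂((gaussMeasure u θ).prod (gaussMeasure u θ)) :=
        lintegral_ncard_collisionTimesOf_le hσ2 ha hθ u Φ hstat hpair htube hlift hw i
    _ ≤ ENNReal.ofReal (32 * σ ^ 2 * aw) *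
          ∫⁻ p, ENNReal.ofReal ‖p.2 - p.1‖ ∂((gaussMeasure u θ).prod (gaussMeasure u θ)) := by
        gcongr


/-! ### The static inputs discharged: every constant profile, every window -/

/-- **The windowed collision count is measurable** (every window `k`): `windowCollisions σ N Φ τ a i k` is the count
of `measurable_windowCount` (H1) on the window `[kw, (k+1)w)`. [folklore] -/
theorem measurable_windowCollisions (σ : ℝ) (N : ℕ)
    (Φ : HardSphereFlow (Torus.geometry (Fin 3)) (hsDiameter σ N) (N + 1)) (τ a : ℝ) (i : Fin (N + 1)) (k : ℕ) :
    Measurable (windowCollisions σ N Φ τ a i k) := by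
  unfold windowCollisions window
  exact measurable_windowCount Φ i _ _

/-- **(a) The one-window count of a tagged sphere has mean `O(σ² a)` under the homogeneous Gibbs law, uniformly in
`N` and in the window index.**  For small reduced density (`SmallDensity uniformProfile σ`), constant profiles
`ab, θb > 0`, `ub`, `N ≥ 1`, every hard-sphere flow `Φ`, `τ, a > 0`, sphere `i` and window `k`:
`∫ D_{i,k} dG_N ≤ 32 σ² a · ∫ ‖w − v‖ dN(ub,θb)^{⊗2}` — window `k` has the law of window `0`
(`windowCollisions_ae_eq_comp_flow`, invariance `measurePreserving_flow_localGibbsLaw_const`, bad set `G_N`-null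
`localGibbsLaw_compl_good_eq_zero`), and window `0` is `lintegral_windowCollisions_zero_le` fed with the Ruelle pair
bound `posGibbs_pairEvent_le`, the swept tube `exists_sweptTube` and the minimal-image lift inequality
`volume_setOf_exists_reprSym_add_latticeVec_mem_le`. [folklore] -/
theorem lintegral_windowCollisions_const_le {σ : ℝ} (hsd : SmallDensity uniformProfile σ) {ab θb : ℝ}
    (hab : 0 < ab) (hθb : 0 < θb) (ub : V3) {N : ℕ} (hN : 1 ≤ N)
    (Φ : HardSphereFlow (Torus.geometry (Fin 3)) (hsDiameter σ N) (N + 1)) {τ a : ℝ} (hτ : 0 < τ) (ha : 0 < a)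
    (i : Fin (N + 1)) (k : ℕ) :
    ∫⁻ z, ENNReal.ofReal (windowCollisions σ N Φ τ a i k z)
        ∂(localGibbsLaw σ (fun _ => ab) (fun _ => ub) (fun _ => θb) N Φ) ≤
      ENNReal.ofReal (32 * σ ^ 2 * a) *
        ∫⁻ p, ENNReal.ofReal ‖p.2 - p.1‖ ∂((gaussMeasure ub θb).prod (gaussMeasure ub θb)) := by
  have hσ := hsd.σ_pos
  have hstat := measurePreserving_flow_localGibbsLaw_const σ ab θb ub N Φ
  have hm0 : Measurable fun z => ENNReal.ofReal (windowCollisions σ N Φ τ a i 0 z) :=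
    (measurable_windowCollisions σ N Φ τ a i 0).ennreal_ofReal
  calc ∫⁻ z, ENNReal.ofReal (windowCollisions σ N Φ τ a i k z)
        ∂(localGibbsLaw σ (fun _ => ab) (fun _ => ub) (fun _ => θb) N Φ)
      = ∫⁻ z, ENNReal.ofReal (windowCollisions σ N Φ τ a i 0 (Φ.flow ((k : ℝ) * windowLen N τ a) z))
          ∂(localGibbsLaw σ (fun _ => ab) (fun _ => ub) (fun _ => θb) N Φ) := by
        refine lintegral_congr_ae ?_
        filter_upwards [windowCollisions_ae_eq_comp_flow Φ _ (localGibbsLaw_compl_good_eq_zero Φ) τ a i k]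
          with z hz
        rw [hz]
    _ = ∫⁻ z, ENNReal.ofReal (windowCollisions σ N Φ τ a i 0 z)
          ∂(localGibbsLaw σ (fun _ => ab) (fun _ => ub) (fun _ => θb) N Φ) := (hstat _).lintegral_comp hm0
    _ ≤ _ := lintegral_windowCollisions_zero_le hσ hsd.σ_lt_half.le hab hθb ub Φ hstat
        (fun p q hpq T hT => posGibbs_pairEvent_le hsd hN hpq hT)
        (fun h hh => exists_sweptTube (hsDiameter_pos hσ N) hh)
        (fun S hS => by simpa only [sub_zero] using volume_setOf_exists_reprSym_add_latticeVec_mem_le 0 hS)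
        hτ ha i

/-- The flux moment `∫ ‖w − v‖ dN(u,θ)^{⊗2}` in (a) is finite (`lintegral_norm_sub_gauss_ne_top`), so (a) is an
honest `N`-uniform first-moment bound: `Σ_i ∫ D_{i,k} dG_N ≤ (N+1) · 32 σ² a ∫‖w − v‖`, the last factor `< ∞`.
[folklore] -/
theorem sum_lintegral_windowCollisions_const_le {σ : ℝ} (hsd : SmallDensity uniformProfile σ) {ab θb : ℝ}
    (hab : 0 < ab) (hθb : 0 < θb) (ub : V3) {N : ℕ} (hN : 1 ≤ N)
    (Φ : HardSphereFlow (Torus.geometry (Fin 3)) (hsDiameter σ N) (N + 1)) {τ a : ℝ} (hτ : 0 < τ) (ha : 0 < a)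
    (k : ℕ) :
    ∑ i : Fin (N + 1), ∫⁻ z, ENNReal.ofReal (windowCollisions σ N Φ τ a i k z)
        ∂(localGibbsLaw σ (fun _ => ab) (fun _ => ub) (fun _ => θb) N Φ) ≤
      ((N + 1 : ℕ) : ℝ≥0∞) * (ENNReal.ofReal (32 * σ ^ 2 * a) *
        ∫⁻ p, ENNReal.ofReal ‖p.2 - p.1‖ ∂((gaussMeasure ub θb).prod (gaussMeasure ub θb))) ∧
      ∫⁻ p, ENNReal.ofReal ‖p.2 - p.1‖ ∂((gaussMeasure ub θb).prod (gaussMeasure ub θb)) ≠ ∞ := by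
  refine ⟨?_, lintegral_norm_sub_gauss_ne_top ub θb⟩
  calc ∑ i : Fin (N + 1), ∫⁻ z, ENNReal.ofReal (windowCollisions σ N Φ τ a i k z)
        ∂(localGibbsLaw σ (fun _ => ab) (fun _ => ub) (fun _ => θb) N Φ)
      ≤ ∑ _i : Fin (N + 1), ENNReal.ofReal (32 * σ ^ 2 * a) *
          ∫⁻ p, ENNReal.ofReal ‖p.2 - p.1‖ ∂((gaussMeasure ub θb).prod (gaussMeasure ub θb)) :=
        Finset.sum_le_sum fun i _ => lintegral_windowCollisions_const_le hsd hab hθb ub hN Φ hτ ha i k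
    _ = _ := by rw [Finset.sum_const, Finset.card_univ, Fintype.card_fin, nsmul_eq_mul]

/-! ## §2 The reduction of S5|const to the one-window second moment -/

/-- **S5|const reduced to the uniform one-window second moment (PM|const).**  IF the squared one-window counts have
`N`-uniform means under the homogeneous Gibbs law at constant profiles — `Σ_i ∫ D_{i,0}² dG_N ≤ C (N+1)` for `N ≥ N₀`,
`C` and `N₀` depending on everything but `N` (hypothesis `hPM`) — THEN the squared window sum
`ε/(N+1) Σ_i Σ_{k<Kw} D_{i,k}²` is tight under `G_N` uniformly in `N`: the conclusion is the registered signature of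
`stub_windowCountSquareTightConst` verbatim.  Proof: Markov and stationarity (`measure_lt_windowSqSum_le` with the
invariance `measurePreserving_flow_localGibbsLaw_const`, the `G_N`-null bad set `localGibbsLaw_compl_good_eq_zero` and the
measurability `measurable_windowCount` of the counts), then `ε Kw ≤ σ (τ/a + 1)` (`hsDiameter_mul_windowNum_le`) and
`Kb = (σ (τ/a + 1) max(C,0) + 1)/δ`. [folklore] -/
theorem stub_windowCountSquareTightConst_of_sqMoment :
    (∀ (ab θb : ℝ) (ub : V3), 0 < ab → 0 < θb → ∃ σ₀ : ℝ, 0 < σ₀ ∧ ∀ σ : ℝ, 0 < σ → σ < σ₀ →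
      ∀ Φ : (N : ℕ) → HardSphereFlow (Torus.geometry (Fin 3)) (hsDiameter σ N) (N + 1),
      ∀ τ : ℝ, 0 < τ → ∀ a : ℝ, 0 < a → ∃ C : ℝ, ∃ N₀ : ℕ, ∀ N : ℕ, N₀ ≤ N →
        ∑ i : Fin (N + 1), ∫⁻ z, ENNReal.ofReal (windowCollisions σ N (Φ N) τ a i 0 z ^ 2)
          ∂(localGibbsLaw σ (fun _ => ab) (fun _ => ub) (fun _ => θb) N (Φ N)) ≤
          ENNReal.ofReal (C * (N + 1 : ℝ))) →
    ∀ (ab θb : ℝ) (ub : V3), 0 < ab → 0 < θb → ∃ σ₀ : ℝ, 0 < σ₀ ∧ ∀ σ : ℝ, 0 < σ → σ < σ₀ →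
      ∀ Φ : (N : ℕ) → HardSphereFlow (Torus.geometry (Fin 3)) (hsDiameter σ N) (N + 1),
      ∀ τ : ℝ, 0 < τ → ∀ a : ℝ, 0 < a → ∀ δ : ℝ, 0 < δ → ∃ Kb : ℝ, ∃ N₀ : ℕ, ∀ N : ℕ, N₀ ≤ N →
        localGibbsLaw σ (fun _ => ab) (fun _ => ub) (fun _ => θb) N (Φ N)
          {z | Kb < hsDiameter σ N / (N + 1 : ℝ) *
              ∑ i : Fin (N + 1), ∑ k ∈ Finset.range (windowNum N τ a), windowCollisions σ N (Φ N) τ a i k z ^ 2}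
          ≤ ENNReal.ofReal δ := by
  intro hPM ab θb ub hab hθb
  obtain ⟨σ₀, hσ₀, H⟩ := hPM ab θb ub hab hθb
  refine ⟨σ₀, hσ₀, fun σ hσ hσlt Φ τ hτ a ha δ hδ => ?_⟩
  obtain ⟨C, N₀, hC⟩ := H σ hσ hσlt Φ τ hτ a ha
  set C' : ℝ := max C 0 with hC'
  have hC'0 : 0 ≤ C' := le_max_right _ _
  set Kb : ℝ := (σ * (τ / a + 1) * C' + 1) / δ with hKbdef
  have hKb : 0 < Kb := by rw [hKbdef]; positivity
  refine ⟨Kb, N₀, fun N hN => ?_⟩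
  set P := localGibbsLaw σ (fun _ => ab) (fun _ => ub) (fun _ => θb) N (Φ N) with hP
  have hred := measure_lt_windowSqSum_le (Φ N) hσ.le P (localGibbsLaw_compl_good_eq_zero (Φ N)) τ a
    (fun k => measurePreserving_flow_localGibbsLaw_const σ ab θb ub N (Φ N) _)
    (fun i k => measurable_windowCollisions σ N (Φ N) τ a i k) hKb
  refine hred.trans ?_
  have hsum : ∑ i : Fin (N + 1), ∫⁻ z, ENNReal.ofReal (windowCollisions σ N (Φ N) τ a i 0 z ^ 2) ∂P ≤
      ENNReal.ofReal (C' * (N + 1 : ℝ)) :=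
    (hC N hN).trans (ENNReal.ofReal_le_ofReal (mul_le_mul_of_nonneg_right (le_max_left _ _) (by positivity)))
  have hεK : hsDiameter σ N * (windowNum N τ a : ℝ) ≤ σ * (τ / a + 1) := hsDiameter_mul_windowNum_le hσ.le N hτ ha
  have hε0 : 0 ≤ hsDiameter σ N := (hsDiameter_pos hσ N).le
  -- the real bound
  have hX : hsDiameter σ N / (N + 1 : ℝ) * (windowNum N τ a : ℝ) * (C' * (N + 1 : ℝ)) / Kb ≤ δ := by
    rw [div_le_iff₀ hKb]
    have h1 : hsDiameter σ N / (N + 1 : ℝ) * (windowNum N τ a : ℝ) * (C' * (N + 1 : ℝ)) =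
        hsDiameter σ N * (windowNum N τ a : ℝ) * C' := by
      field_simp
    rw [h1]
    have h2 : hsDiameter σ N * (windowNum N τ a : ℝ) * C' ≤ σ * (τ / a + 1) * C' :=
      mul_le_mul_of_nonneg_right hεK hC'0
    have h3 : δ * Kb = σ * (τ / a + 1) * C' + 1 := by rw [hKbdef]; field_simp
    linarith
  calc (ENNReal.ofReal Kb)⁻¹ * (ENNReal.ofReal (hsDiameter σ N / (N + 1 : ℝ)) * (windowNum N τ a : ℝ≥0∞) *
        ∑ i : Fin (N + 1), ∫⁻ z, ENNReal.ofReal (windowCollisions σ N (Φ N) τ a i 0 z ^ 2) ∂P)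
      ≤ (ENNReal.ofReal Kb)⁻¹ * (ENNReal.ofReal (hsDiameter σ N / (N + 1 : ℝ)) * (windowNum N τ a : ℝ≥0∞) *
        ENNReal.ofReal (C' * (N + 1 : ℝ))) := by gcongr
    _ = ENNReal.ofReal (hsDiameter σ N / (N + 1 : ℝ) * (windowNum N τ a : ℝ) * (C' * (N + 1 : ℝ)) / Kb) := by
        rw [← ENNReal.ofReal_natCast (windowNum N τ a), ← ENNReal.ofReal_mul (by positivity),
          ← ENNReal.ofReal_mul (by positivity), ENNReal.ofReal_div_of_pos hKb, ENNReal.div_eq_inv_mul]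
    _ ≤ ENNReal.ofReal δ := ENNReal.ofReal_le_ofReal hX

end Summit.AtomisticToContinuum.HydrodynamicLimit.Theorems.CollisionRate

end
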